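import Literature.NumberTheory.EllipticCurves.AnticyclotomicInertiaAboveP
import Literature.NumberTheory.EllipticCurves.AnticyclotomicPrimeDecomposition
import Literature.NumberTheory.EllipticCurves.Rubin1991.TwoVariableMainConjecture
import HarnessLib

/-!
# The CFT input of the Galois control: `K̃_∞ / K_∞⁻` is unramified above `p` — in the
# `GreenbergSelmer.inertia` formalism of the control files
# (helper file 16 for crux 2 `GoodLatticeBDPValue`, stmt-BirchSwinnertonDyer-19032, cell `bsd-eis` seat `bsd-eis-k5-c2`)

The control files (`exists_controlMap`, `exists_descentMap`, `muLambda_of_twoVariable`) carry the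
hypothesis `hIp : ∀ w ∣ p, ker κ ⊓ I_w ≤ ker κ'` with `I_w = GreenbergSelmer.inertia w` (the image of
the local inertia group under `Γ_{K_w} → Γ_K`). The cell's typer PROVED the statement from the tree's
class field theory (k5-ty g6, p461875, `Literature/…/AnticyclotomicInertiaAboveP.lean`:
`ZpExtension.inertia_inf_kerSubgroup_le_kerSubgroup_of_isAnticyclotomic`, for Mathlib's
`Ideal.inertia` of any prime `𝔓` of `\bar ℤ_K` above `w`). This file is the bridge:

* `greenbergSelmer_inertia_eq` — `GreenbergSelmer.inertia w = I_{𝔓₀}`, `𝔓₀ = adicCompletionPrime K w`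
  (Neukirch II (9.6), the tree's `inertia_adicCompletionPrime_eq_map_absInertia`);
* `kerSubgroup_inf_inertia_le_of_isAnticyclotomic` — **`hIp` DISCHARGED**: for `K` imaginary
  quadratic (`K : Type`), `p` odd with two places `v ≠ v̄` above it (split), `κ` anticyclotomic and
  ANY `ℤ_p`-extension `κ'`: `∀ w ∣ p, ker κ ⊓ GreenbergSelmer.inertia w ≤ ker κ'`;
* `inertia_not_le_kerSubgroup_above_of_isAnticyclotomic_holds` — the named fact
  `ZpExtension.inertia_not_le_kerSubgroup_above_of_isAnticyclotomic` (Brink 2007 Cor. 1, inertia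
  form; this seat's Literature append p462344) DISCHARGED at `K : Type` from the typer's
  `inertia_not_le_kerSubgroup_of_isAnticyclotomic` (debt −1; its companion
  `inertia_image_cyclic_of_degree_one` stays a cited fact, unused by the road after p461875).

HONEST FRAMING: plumbing between two inertia formalisms; closes nothing by itself.
References: Neukirch ANT II (9.6); Brink 2007 Cor. 1; Greenberg LNM 1716 §1 p. 53; k5-ty g6 p461875.
-/

-- the summit namespace `Summit.BirchSwinnertonDyer.BirchSwinnertonDyer` repeats the problem name by design (D-0017)
set_option linter.dupNamespace false
set_option autoImplicit false

noncomputable section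

open NumberField IsDedekindDomain Field Literature.NumberTheory.GaloisRepresentations
  Literature.NumberTheory.EllipticCurves

namespace Summit.BirchSwinnertonDyer.BirchSwinnertonDyer.Theorems.IwasawaTwoVariable

section Bridge

variable {K : Type} [Field K] [NumberField K] {p : ℕ} [Fact p.Prime]

/-- **`GreenbergSelmer.inertia w = I_{𝔓₀}`** for the prime `𝔓₀ = adicCompletionPrime K w` of `\bar ℤ_K`
singled out by the chosen embedding `K̄ → \bar K_w` (both are the image of the local inertia group;
Neukirch II (9.6)). [cite: NeukirchANT1999, Ch. II §9 Prop. (9.6)] -/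
theorem greenbergSelmer_inertia_eq (w : HeightOneSpectrum (𝓞 K)) :
    GreenbergSelmer.inertia w = (adicCompletionPrime K w).inertia (absoluteGaloisGroup K) := by
  rw [GreenbergSelmer.inertia, inertia_adicCompletionPrime_eq_map_absInertia]

/-- **`hIp` discharged: `K̃_∞ / K_∞⁻` is unramified above `p`.** For `K` imaginary quadratic, `p`
odd with two distinct places `v ≠ v̄` above it, `κ` anticyclotomic and ANY `ℤ_p`-extension `κ'` of
`K`: at every place `w ∣ p`, `ker κ ⊓ I_w ≤ ker κ'` (`I_w = GreenbergSelmer.inertia w`) — the typer's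
`ZpExtension.inertia_inf_kerSubgroup_le_kerSubgroup_of_isAnticyclotomic` (local Kronecker–Weber
proportionality on `I_{ℚ_p}` + Brink's ramification of `K^anti` above `p`) read at
`𝔓₀ = adicCompletionPrime K w`. The hypothesis of `exists_controlMap` / `exists_descentMap` /
`muLambda_of_twoVariable` for the anticyclotomic line. [cite: GreenbergLNM1716, §1 p. 53]
[cite: Brink2007, Cor. 1 (p. 2136)] -/
theorem kerSubgroup_inf_inertia_le_of_isAnticyclotomic (hK : IsImaginaryQuadratic K) (hp2 : p ≠ 2)
    {κ : ZpExtension K p} (hκ : κ.IsAnticyclotomic) (κ' : ZpExtension K p)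
    {v vbar : HeightOneSpectrum (𝓞 K)} (hpv : ((p : ℕ) : 𝓞 K) ∈ v.asIdeal)
    (hpvbar : ((p : ℕ) : 𝓞 K) ∈ vbar.asIdeal) (hne : vbar ≠ v) :
    ∀ w : HeightOneSpectrum (𝓞 K), ((p : ℕ) : 𝓞 K) ∈ w.asIdeal →
      κ.kerSubgroup ⊓ GreenbergSelmer.inertia w ≤ κ'.kerSubgroup := by
  intro w hpw x hx
  have hxI : x ∈ (adicCompletionPrime K w).inertia (absoluteGaloisGroup K) := by
    rw [← greenbergSelmer_inertia_eq]
    exact hx.2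
  exact ZpExtension.inertia_inf_kerSubgroup_le_kerSubgroup_of_isAnticyclotomic hK hp2 hκ κ' hpv
    hpvbar hne hpw (adicCompletionPrime_mem_primesAbove K w) ⟨hxI, hx.1⟩

variable (K p) in
/-- **The named fact `ZpExtension.inertia_not_le_kerSubgroup_above_of_isAnticyclotomic` HOLDS** (at
`K : Type`): Brink 2007 Cor. 1 in inertia form, `I_v ⊄ ker κ` for `κ` anticyclotomic and `v ∣ p` —
from the typer's theorem `ZpExtension.inertia_not_le_kerSubgroup_of_isAnticyclotomic` (every layer
would be unramified everywhere, so `pⁿ ∣ h_K` for all `n`) read at `𝔓₀ = adicCompletionPrime K v`.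
[cite: Brink2007, Cor. 1 (p. 2136) and its proof] -/
theorem inertia_not_le_kerSubgroup_above_of_isAnticyclotomic_holds :
    ZpExtension.inertia_not_le_kerSubgroup_above_of_isAnticyclotomic K p := by
  intro hK hp2 κ hκ v hpv hle
  refine ZpExtension.inertia_not_le_kerSubgroup_of_isAnticyclotomic hK hp2 κ hκ hpv
    (adicCompletionPrime_mem_primesAbove K v) ?_
  rw [← greenbergSelmer_inertia_eq]
  exact hle

end Bridge

end Summit.BirchSwinnertonDyer.BirchSwinnertonDyer.Theorems.IwasawaTwoVariable

end
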